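import Summits.BirchSwinnertonDyer.BirchSwinnertonDyer.Theorems.BiquadraticEisensteinDescentHeegnerTwistCouplingInSupplySqrtTwoCorner
import Summits.BirchSwinnertonDyer.BirchSwinnertonDyer.Theorems.BiquadraticEisensteinDescentHeegnerTwistCouplingInSupplyPartnerLadder
import HarnessLib

set_option linter.dupNamespace false -- `Summit.BirchSwinnertonDyer.BirchSwinnertonDyer.Theorems.…` (summit = sub)
set_option autoImplicit false

/-!
# Crux `HeegnerTwistCouplingInSupply` (stmt-BirchSwinnertonDyer-21381) — card `sqrt2-isogeny-heegner-pin`: the CELL-5 PARTNER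
# LADDER on the `j = 8000` corner `W = B_p`, `p ≡ 5 (mod 8)` (partners `q₀ ≡ 5 (mod 8)` with `(q₀/p) = −1`), modulo Burungale–Tian +
# Deuring–Hecke

Route `BiquadraticEisensteinDescent` (cell `pub/bsd-wall`, width seat `bsd-wall-cm-bed-w1` g10; `--supports` 21381, helper). Sequel of
`…SqrtTwoCorner` (T_A: partner `5`, i.e. `p ≡ ±2 (mod 5)`). The card's "cascade `q₀ ∈ {13, 29, 37, …}` (ℓ₃-side)": for a prime
`p ≡ 5 (mod 8)` and a prime `q₀ ≡ 5 (mod 8)` with `(q₀/p) = −1`, take the pin `ℓ ≡ 3 (mod 8)`, `(ℓ/p) = −1`, `ℓ < p`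
(`pinThreeMinus_of_mod_eight_eq_five`) and `K′ = ℚ(√−q₀ℓ)`: `d_{K′} = −q₀ℓ ≡ 1 (mod 8)` (2 splits), `(d_{K′}/p) = (q₀/p)(ℓ/p) = +1`
(`p ≡ 1 (mod 4)`, p splits), so `K′` is Heegner for `N(B_p)` (support `⊆ {2, p}`, `…SqrtTwoCorner`); the twist `B_p^{(−q₀ℓ)} = B_{−m}`,
`m = p·ℓ·q₀` square-free with all prime factors `≡ ±3 (mod 8)`, lies in CELL-5 (`…SqrtTwoCell`, UNCONDITIONAL descent), so
`L(B_p^{(d_{K′})}, 1) ≠ 0` modulo Burungale–Tian + Deuring–Hecke (`L_one_ne_zero_B_neg`); and `h(K′) < p` by the size lever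
(`classNumber_lt_of_lever`, `|d| = q₀ℓ < q₀·p`, threshold `8⁸q₀⁵ ≤ (2.718·3.1415)⁸P³`: `P(13) = 61`, `P(29) = 231`, `P(37) = 346`,
`P(53) = 629`, `P(61) = 795`).

* §1 bookkeeping (`(−q₀ℓ/p) = +1` for `p ≡ 1 (mod 4)`; `p·ℓ·q₀` square-free with prime factors `≡ 3, 5 (mod 8)`; the twist literal);
* §2 ★ `cruxOnBpCornerPartner_of_two_facts` — the GENERIC rung (any `q₀ ≡ 5 (mod 8)`, any `P` above the threshold);
* §3 rungs `q₀ = 13, 29, 37, 53, 61` and ★★ `cruxOnBpCornerLadder_of_two_facts`: the crux CONCLUSION for `W = B_p` for every prime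
  `p ≡ 5 (mod 8)` with `p ≡ ±2 (5)` ∨ (`(13/p) = −1`, `p ≥ 61`) ∨ (`(29/p) = −1`, `p ≥ 231`) ∨ (`(37/p) = −1`, `p ≥ 346`) ∨
  (`(53/p) = −1`, `p ≥ 629`) ∨ (`(61/p) = −1`, `p ≥ 795`) — `63/64` of the class `p ≡ 5 (mod 8)` above `795`, two named facts.

HONEST FRAMING: typed sub-corner rungs on one CM family; the residual (every listed partner a residue mod `p`) has positive density for
every finite ladder; the crux (all CM `W`; residual C⁺) and BSD are NOT proved by any of this. THEOREMS ONLY; supports 21381.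
-/

noncomputable section

open scoped Classical

namespace Summit.BirchSwinnertonDyer.BirchSwinnertonDyer.Theorems.BiquadraticEisensteinDescentHeegnerTwistCouplingInSupplySqrtTwoLadder

open _root_.WeierstrassCurve Literature.NumberTheory.EllipticCurves Literature.NumberTheory.EllipticCurves.HeathBrown1994.Families
open Summit.BirchSwinnertonDyer.BirchSwinnertonDyer.Theorems.BiquadraticEisensteinDescentHeegnerTwistCouplingInSupplySqrtTwoCell
open Summit.BirchSwinnertonDyer.BirchSwinnertonDyer.Theorems.BiquadraticEisensteinDescentHeegnerTwistCouplingInSupplySqrtTwoCorner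
open Summit.BirchSwinnertonDyer.BirchSwinnertonDyer.Theorems.BiquadraticEisensteinDescentHeegnerTwistCouplingInSupplySqrtTwoPin
open Summit.BirchSwinnertonDyer.BirchSwinnertonDyer.Theorems.BiquadraticEisensteinDescentHeegnerTwistCouplingInSupplyPartnerLadder

/-! ## §1 Bookkeeping -/

/-- `(−qℓ/p) = +1` for `p ≡ 1 (mod 4)` when `(q/p) = (ℓ/p) = −1`. [folklore] -/
theorem jacobiSym_neg_mul_eq_one_of_mod_four_eq_one {p q l : ℕ} (hp4 : p % 4 = 1) (hq : jacobiSym (q : ℤ) p = -1)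
    (hl : jacobiSym (l : ℤ) p = -1) : jacobiSym (-((q * l : ℕ) : ℤ)) p = 1 := by
  have hm1 : jacobiSym (-1) p = 1 := jacobiSym_neg_one_eq_one hp4
  have : (-((q * l : ℕ) : ℤ)) = (-1) * (q : ℤ) * (l : ℤ) := by push_cast; ring
  rw [this, jacobiSym.mul_left, jacobiSym.mul_left, hm1, hq, hl]
  norm_num

/-- A prime `q` with `(q/p) = −1` is not `p`. [folklore] -/
theorem ne_of_jacobiSym_eq_neg_one {p q : ℕ} (hp : p.Prime) (h : jacobiSym (q : ℤ) p = -1) : q ≠ p := by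
  rintro rfl
  rw [jacobiSym.mod_left, Int.emod_self, jacobiSym.zero_left hp.one_lt] at h
  norm_num at h

/-- Three distinct primes have a square-free product whose prime factors are among them. [folklore] -/
theorem squarefree_mul_mul_of_primes {p l q : ℕ} (hp : p.Prime) (hl : l.Prime) (hq : q.Prime) (hpl : p ≠ l) (hpq : p ≠ q)
    (hlq : l ≠ q) : Squarefree (p * l * q) ∧ ∀ r : ℕ, r.Prime → r ∣ p * l * q → r = p ∨ r = l ∨ r = q := by
  refine ⟨?_, fun r hr hrd => ?_⟩
  · have h1 : Squarefree (p * l) := by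
      rw [Nat.squarefree_mul ((Nat.coprime_primes hp hl).mpr hpl)]
      exact ⟨hp.squarefree, hl.squarefree⟩
    have hcop : Nat.Coprime (p * l) q :=
      Nat.Coprime.mul_left ((Nat.coprime_primes hp hq).mpr hpq) ((Nat.coprime_primes hl hq).mpr hlq)
    rw [Nat.squarefree_mul hcop]
    exact ⟨h1, hq.squarefree⟩
  · rcases (Nat.Prime.dvd_mul hr).mp hrd with h | h
    · rcases (Nat.Prime.dvd_mul hr).mp h with h' | h'
      · exact Or.inl ((Nat.prime_dvd_prime_iff_eq hr hp).mp h')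
      · exact Or.inr (Or.inl ((Nat.prime_dvd_prime_iff_eq hr hl).mp h'))
    · exact Or.inr (Or.inr ((Nat.prime_dvd_prime_iff_eq hr hq).mp h))

/-- `B_p^{(−qℓ)}` is the CELL-5 literal `B_{−m}` with `m = p·q·ℓ`. [cite: SilvermanAEC2009, X.2 and X.5] -/
theorem quadraticTwist_B_neg_mul (p q l : ℕ) :
    (⟨0, 4 * (p : ℚ), 0, 2 * (p : ℚ) ^ 2, 0⟩ : WeierstrassCurve ℚ).quadraticTwist ((-((q * l : ℕ) : ℤ) : ℤ) : ℚ) =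
      ⟨0, -4 * (((p * q * l : ℕ) : ℤ) : ℚ), 0, 2 * (((p * q * l : ℕ) : ℤ) : ℚ) ^ 2, 0⟩ := by
  rw [quadraticTwist_B]
  ext <;> push_cast <;> ring

/-! ## §2 ★ The generic CELL-5 rung -/

/-- ★ **Generic CELL-5 rung, two named facts.** Let `q₀ ≡ 5 (mod 8)` be prime and `P` a threshold with
`8⁸ q₀⁵ ≤ (2.718·3.1415)⁸ P³`. For every prime `p ≡ 5 (mod 8)` with `(q₀/p) = −1` and `p ≥ P`, and `W = B_p`: there is a Heegner field
`K′` (`= ℚ(√−q₀ℓ)`, `ℓ` the `(3,−)` pin) of `N(B_p)` with `4 < |d_{K′}|`, `L(B_p^{(d_{K′})}, 1) ≠ 0` (CELL-5 at `m = p·ℓ·q₀`),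
`h(K′) < p` (size lever, `c = q₀`) and `p ∤ h(K′)` — modulo Burungale–Tian + Deuring–Hecke.
[cite: BurungaleTian2026, Thm. 1.1] [cite: SilvermanAEC2009, Prop. X.4.9 and Thm. X.4.2(a)] [cite: Oesterle1988Gauss, II §3 Proposition p. 57 (27)] -/
theorem cruxOnBpCornerPartner_of_two_facts (hBT : burungaleTian_analyticRank_eq_zero_of_selmerCorank_eq_zero_of_hasCM)
    (hH : hasEntireLFunction_of_j_mem_maximalCMJInvariants) {q₀ P : ℕ} (hq₀ : q₀.Prime) (hq₀8 : q₀ % 8 = 5)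
    (hkey : (8 : ℝ) ^ 8 * ((q₀ : ℕ) : ℝ) ^ 5 ≤ (2.718 * 3.1415) ^ 8 * (P : ℝ) ^ 3) :
    ∀ (p : ℕ) [Fact p.Prime] [(⟨0, 4 * (p : ℚ), 0, 2 * (p : ℚ) ^ 2, 0⟩ : WeierstrassCurve ℚ).IsElliptic]
      [(⟨0, 4 * (p : ℚ), 0, 2 * (p : ℚ) ^ 2, 0⟩ : WeierstrassCurve ℚ).IsGloballyMinimal]
      [NeZero ((⟨0, 4 * (p : ℚ), 0, 2 * (p : ℚ) ^ 2, 0⟩ : WeierstrassCurve ℚ).conductorNorm ℤ)],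
      p % 8 = 5 → jacobiSym (q₀ : ℤ) p = -1 → P ≤ p →
      ∃ (K : Type) (_ : Field K) (_ : NumberField K),
        IsImaginaryQuadratic K ∧ 4 < (NumberField.discr K).natAbs ∧
        SatisfiesHeegnerHypothesis ((⟨0, 4 * (p : ℚ), 0, 2 * (p : ℚ) ^ 2, 0⟩ : WeierstrassCurve ℚ).conductorNorm ℤ) K ∧
        ((⟨0, 4 * (p : ℚ), 0, 2 * (p : ℚ) ^ 2, 0⟩ : WeierstrassCurve ℚ).quadraticTwist (NumberField.discr K : ℚ)).entireLFunction 1 ≠ 0 ∧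
        NumberField.classNumber K < p ∧ ¬ p ∣ NumberField.classNumber K := by
  intro p hpF _ _ _ hp8 hJq hPp
  have hp : p.Prime := hpF.out
  obtain ⟨ℓ, hℓ, hℓp, hℓ8, hJℓ⟩ := pinThreeMinus_of_mod_eight_eq_five p hp hp8
  have hJ : jacobiSym (-((ℓ * q₀ : ℕ) : ℤ)) p = 1 := jacobiSym_neg_mul_eq_one_of_mod_four_eq_one (by omega) hJℓ hJq
  have hxc : ((ℓ * q₀ : ℕ) : ℝ) < (q₀ : ℝ) * p := by
    have h1 : ℓ * q₀ < q₀ * p := by have := hq₀.pos; nlinarith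
    exact_mod_cast h1
  obtain ⟨K, iF, iN, hK, hdK, hH', hcl⟩ := exists_witnessField_of
    (N := (⟨0, 4 * (p : ℚ), 0, 2 * (p : ℚ) ^ 2, 0⟩ : WeierstrassCurve ℚ).conductorNorm ℤ) hℓ hℓ8 hq₀ hq₀8 hJ
    (classNumber_lt_of_lever hℓ hq₀ hq₀8 hxc hkey hPp) (fun r hr hrN => eq_two_or_eq_of_prime_dvd_conductorNorm_B hp hr hrN)
  refine ⟨K, iF, iN, hK, ?_, hH', ?_, hcl, fun hdvd =>
    absurd (Nat.le_of_dvd (NumberField.classNumber_pos K) hdvd) (not_le.mpr hcl)⟩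
  · rw [hdK, Int.natAbs_neg, Int.natAbs_natCast]
    have h3 : 3 ≤ ℓ := by have := hℓ.two_le; omega
    have h5 : 5 ≤ q₀ := by have := hq₀.two_le; omega
    nlinarith
  · rw [hdK, quadraticTwist_B_neg_mul]
    have hℓq : ℓ ≠ q₀ := by rintro rfl; omega
    obtain ⟨hsq, hfac⟩ := squarefree_mul_mul_of_primes hp hℓ hq₀ (by omega) (ne_of_jacobiSym_eq_neg_one hp hJq).symm hℓq
    have hm0 : (0 : ℤ) < ((p * ℓ * q₀ : ℕ) : ℤ) := by
      have := hp.pos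
      have := hℓ.pos
      have := hq₀.pos
      positivity
    have hm8 : ∀ r : ℕ, r.Prime → (r : ℤ) ∣ ((p * ℓ * q₀ : ℕ) : ℤ) → r % 8 = 3 ∨ r % 8 = 5 := by
      intro r hr hrd
      rcases hfac r hr (by exact_mod_cast hrd) with rfl | rfl | rfl <;> omega
    haveI := isElliptic_B hm0.ne'
    exact (L_one_ne_zero_B_neg hBT hH hm0 (Int.squarefree_natCast.mpr hsq) hm8).2

/-! ## §3 Rungs and the ladder -/

/-- Rung `q₀ = 13` (`P = 61`). [cite: Oesterle1988Gauss, II §3 Proposition p. 57 (27)] -/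
theorem hkey_thirteen : (8 : ℝ) ^ 8 * ((13 : ℕ) : ℝ) ^ 5 ≤ (2.718 * 3.1415) ^ 8 * ((61 : ℕ) : ℝ) ^ 3 := by norm_num

/-- Rung `q₀ = 29` (`P = 231`). [cite: Oesterle1988Gauss, II §3 Proposition p. 57 (27)] -/
theorem hkey_twentyNine : (8 : ℝ) ^ 8 * ((29 : ℕ) : ℝ) ^ 5 ≤ (2.718 * 3.1415) ^ 8 * ((231 : ℕ) : ℝ) ^ 3 := by norm_num

/-- Rung `q₀ = 37` (`P = 346`). [cite: Oesterle1988Gauss, II §3 Proposition p. 57 (27)] -/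
theorem hkey_thirtySeven : (8 : ℝ) ^ 8 * ((37 : ℕ) : ℝ) ^ 5 ≤ (2.718 * 3.1415) ^ 8 * ((346 : ℕ) : ℝ) ^ 3 := by norm_num

/-- Rung `q₀ = 53` (`P = 629`). [cite: Oesterle1988Gauss, II §3 Proposition p. 57 (27)] -/
theorem hkey_fiftyThree : (8 : ℝ) ^ 8 * ((53 : ℕ) : ℝ) ^ 5 ≤ (2.718 * 3.1415) ^ 8 * ((629 : ℕ) : ℝ) ^ 3 := by norm_num

/-- Rung `q₀ = 61` (`P = 795`). [cite: Oesterle1988Gauss, II §3 Proposition p. 57 (27)] -/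
theorem hkey_sixtyOne : (8 : ℝ) ^ 8 * ((61 : ℕ) : ℝ) ^ 5 ≤ (2.718 * 3.1415) ^ 8 * ((795 : ℕ) : ℝ) ^ 3 := by norm_num

/-- ★★ **THE CELL-5 LADDER on the `j = 8000` corner, two named facts.** For every prime `p ≡ 5 (mod 8)` with `p ≡ ±2 (mod 5)`, or
`(13/p) = −1` and `p ≥ 61`, or `(29/p) = −1` and `p ≥ 231`, or `(37/p) = −1` and `p ≥ 346`, or `(53/p) = −1` and `p ≥ 629`, or
`(61/p) = −1` and `p ≥ 795`, and `W = B_p : y² = x³ + 4p x² + 2p² x`: the CONCLUSION of crux 21381 (a Heegner field `K′` of `N(B_p)`,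
`4 < |d_{K′}|`, `L(B_p^{(d_{K′})}, 1) ≠ 0`, `h(K′) < p`, `p ∤ h(K′)`) modulo Burungale–Tian + Deuring–Hecke ONLY.
[cite: BurungaleTian2026, Thm. 1.1] [cite: SilvermanAEC2009, Prop. X.4.9 and Thm. X.4.2(a)] [cite: Oesterle1988Gauss, II §3 Proposition p. 57 (27)] -/
theorem cruxOnBpCornerLadder_of_two_facts (hBT : burungaleTian_analyticRank_eq_zero_of_selmerCorank_eq_zero_of_hasCM)
    (hH : hasEntireLFunction_of_j_mem_maximalCMJInvariants) :
    ∀ (p : ℕ) [Fact p.Prime] [(⟨0, 4 * (p : ℚ), 0, 2 * (p : ℚ) ^ 2, 0⟩ : WeierstrassCurve ℚ).IsElliptic]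
      [(⟨0, 4 * (p : ℚ), 0, 2 * (p : ℚ) ^ 2, 0⟩ : WeierstrassCurve ℚ).IsGloballyMinimal]
      [NeZero ((⟨0, 4 * (p : ℚ), 0, 2 * (p : ℚ) ^ 2, 0⟩ : WeierstrassCurve ℚ).conductorNorm ℤ)],
      p % 8 = 5 →
      ((p % 5 = 2 ∨ p % 5 = 3) ∨ (jacobiSym (13 : ℤ) p = -1 ∧ 61 ≤ p) ∨ (jacobiSym (29 : ℤ) p = -1 ∧ 231 ≤ p) ∨
        (jacobiSym (37 : ℤ) p = -1 ∧ 346 ≤ p) ∨ (jacobiSym (53 : ℤ) p = -1 ∧ 629 ≤ p) ∨ (jacobiSym (61 : ℤ) p = -1 ∧ 795 ≤ p)) →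
      ∃ (K : Type) (_ : Field K) (_ : NumberField K),
        IsImaginaryQuadratic K ∧ 4 < (NumberField.discr K).natAbs ∧
        SatisfiesHeegnerHypothesis ((⟨0, 4 * (p : ℚ), 0, 2 * (p : ℚ) ^ 2, 0⟩ : WeierstrassCurve ℚ).conductorNorm ℤ) K ∧
        ((⟨0, 4 * (p : ℚ), 0, 2 * (p : ℚ) ^ 2, 0⟩ : WeierstrassCurve ℚ).quadraticTwist (NumberField.discr K : ℚ)).entireLFunction 1 ≠ 0 ∧
        NumberField.classNumber K < p ∧ ¬ p ∣ NumberField.classNumber K := by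
  intro p hpF _ _ _ hp8 hcase
  rcases hcase with h5 | ⟨h13, hge⟩ | ⟨h29, hge⟩ | ⟨h37, hge⟩ | ⟨h53, hge⟩ | ⟨h61, hge⟩
  · exact cruxOnBpCorner_of_two_facts hBT hH p hp8 h5
  · exact cruxOnBpCornerPartner_of_two_facts hBT hH (by norm_num) (by norm_num) hkey_thirteen p hp8
      (by exact_mod_cast h13) hge
  · exact cruxOnBpCornerPartner_of_two_facts hBT hH (by norm_num) (by norm_num) hkey_twentyNine p hp8
      (by exact_mod_cast h29) hge
  · exact cruxOnBpCornerPartner_of_two_facts hBT hH (by norm_num) (by norm_num) hkey_thirtySeven p hp8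
      (by exact_mod_cast h37) hge
  · exact cruxOnBpCornerPartner_of_two_facts hBT hH (by norm_num) (by norm_num) hkey_fiftyThree p hp8
      (by exact_mod_cast h53) hge
  · exact cruxOnBpCornerPartner_of_two_facts hBT hH (by norm_num) (by norm_num) hkey_sixtyOne p hp8
      (by exact_mod_cast h61) hge

/-! ## §4 (append) Taller rungs `q₀ = 101, 109, 149, 157, 173, 181, 197` and the extended ladder -/

/-- Rung `q₀ = 101` (`P = 1842`). [cite: Oesterle1988Gauss, II §3 Proposition p. 57 (27)] -/
theorem hkey_oneHundredOne : (8 : ℝ) ^ 8 * ((101 : ℕ) : ℝ) ^ 5 ≤ (2.718 * 3.1415) ^ 8 * ((1842 : ℕ) : ℝ) ^ 3 := by norm_num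

/-- Rung `q₀ = 109` (`P = 2091`). [cite: Oesterle1988Gauss, II §3 Proposition p. 57 (27)] -/
theorem hkey_oneHundredNine : (8 : ℝ) ^ 8 * ((109 : ℕ) : ℝ) ^ 5 ≤ (2.718 * 3.1415) ^ 8 * ((2091 : ℕ) : ℝ) ^ 3 := by norm_num

/-- Rung `q₀ = 149` (`P = 3520`). [cite: Oesterle1988Gauss, II §3 Proposition p. 57 (27)] -/
theorem hkey_oneHundredFortyNine : (8 : ℝ) ^ 8 * ((149 : ℕ) : ℝ) ^ 5 ≤ (2.718 * 3.1415) ^ 8 * ((3520 : ℕ) : ℝ) ^ 3 := by norm_num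

/-- Rung `q₀ = 157` (`P = 3841`). [cite: Oesterle1988Gauss, II §3 Proposition p. 57 (27)] -/
theorem hkey_oneHundredFiftySeven : (8 : ℝ) ^ 8 * ((157 : ℕ) : ℝ) ^ 5 ≤ (2.718 * 3.1415) ^ 8 * ((3841 : ℕ) : ℝ) ^ 3 := by norm_num

/-- Rung `q₀ = 173` (`P = 4515`). [cite: Oesterle1988Gauss, II §3 Proposition p. 57 (27)] -/
theorem hkey_oneHundredSeventyThree : (8 : ℝ) ^ 8 * ((173 : ℕ) : ℝ) ^ 5 ≤ (2.718 * 3.1415) ^ 8 * ((4515 : ℕ) : ℝ) ^ 3 := by norm_num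

/-- Rung `q₀ = 181` (`P = 4868`). [cite: Oesterle1988Gauss, II §3 Proposition p. 57 (27)] -/
theorem hkey_oneHundredEightyOne : (8 : ℝ) ^ 8 * ((181 : ℕ) : ℝ) ^ 5 ≤ (2.718 * 3.1415) ^ 8 * ((4868 : ℕ) : ℝ) ^ 3 := by norm_num

/-- Rung `q₀ = 197` (`P = 5606`). [cite: Oesterle1988Gauss, II §3 Proposition p. 57 (27)] -/
theorem hkey_oneHundredNinetySeven : (8 : ℝ) ^ 8 * ((197 : ℕ) : ℝ) ^ 5 ≤ (2.718 * 3.1415) ^ 8 * ((5606 : ℕ) : ℝ) ^ 3 := by norm_num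

/-- ★★ **THE EXTENDED CELL-5 LADDER (partners `5, 13, 29, 37, 53, 61, 101, 109, 149, 157, 173, 181, 197`), two named facts.** For every prime
`p ≡ 5 (mod 8)` such that `p ≡ ±2 (mod 5)` or some `q₀ ∈ {13, 29, 37, 53, 61, 101, 109, 149, 157, 173, 181, 197}` has `(q₀/p) = −1` with `p` above
the threshold `P(q₀) ∈ {61, 231, 346, 629, 795, 1842, 2091, 3520, 3841, 4515, 4868, 5606}`: the CONCLUSION of crux 21381 for `W = B_p`, modulo
Burungale–Tian + Deuring–Hecke ONLY. (Script `gap.py`, seat folder: together with the five rows of `…SqrtTwoLadderRows` this covers EVERY prime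
`p ≡ 5 (mod 8)` below `2·10⁵`; the structural residual — all thirteen partners residues — has density `2⁻¹³` in the class and no member below `2·10⁵`.)
[cite: BurungaleTian2026, Thm. 1.1] [cite: SilvermanAEC2009, Prop. X.4.9 and Thm. X.4.2(a)] [cite: Oesterle1988Gauss, II §3 Proposition p. 57 (27)] -/
theorem cruxOnBpCornerLadderExt_of_two_facts (hBT : burungaleTian_analyticRank_eq_zero_of_selmerCorank_eq_zero_of_hasCM)
    (hH : hasEntireLFunction_of_j_mem_maximalCMJInvariants) :
    ∀ (p : ℕ) [Fact p.Prime] [(⟨0, 4 * (p : ℚ), 0, 2 * (p : ℚ) ^ 2, 0⟩ : WeierstrassCurve ℚ).IsElliptic]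
      [(⟨0, 4 * (p : ℚ), 0, 2 * (p : ℚ) ^ 2, 0⟩ : WeierstrassCurve ℚ).IsGloballyMinimal]
      [NeZero ((⟨0, 4 * (p : ℚ), 0, 2 * (p : ℚ) ^ 2, 0⟩ : WeierstrassCurve ℚ).conductorNorm ℤ)],
      p % 8 = 5 →
      ((p % 5 = 2 ∨ p % 5 = 3) ∨ (jacobiSym (13 : ℤ) p = -1 ∧ 61 ≤ p) ∨ (jacobiSym (29 : ℤ) p = -1 ∧ 231 ≤ p) ∨
        (jacobiSym (37 : ℤ) p = -1 ∧ 346 ≤ p) ∨ (jacobiSym (53 : ℤ) p = -1 ∧ 629 ≤ p) ∨ (jacobiSym (61 : ℤ) p = -1 ∧ 795 ≤ p) ∨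
        (jacobiSym (101 : ℤ) p = -1 ∧ 1842 ≤ p) ∨ (jacobiSym (109 : ℤ) p = -1 ∧ 2091 ≤ p) ∨ (jacobiSym (149 : ℤ) p = -1 ∧ 3520 ≤ p) ∨
        (jacobiSym (157 : ℤ) p = -1 ∧ 3841 ≤ p) ∨ (jacobiSym (173 : ℤ) p = -1 ∧ 4515 ≤ p) ∨ (jacobiSym (181 : ℤ) p = -1 ∧ 4868 ≤ p) ∨
        (jacobiSym (197 : ℤ) p = -1 ∧ 5606 ≤ p)) →
      ∃ (K : Type) (_ : Field K) (_ : NumberField K),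
        IsImaginaryQuadratic K ∧ 4 < (NumberField.discr K).natAbs ∧
        SatisfiesHeegnerHypothesis ((⟨0, 4 * (p : ℚ), 0, 2 * (p : ℚ) ^ 2, 0⟩ : WeierstrassCurve ℚ).conductorNorm ℤ) K ∧
        ((⟨0, 4 * (p : ℚ), 0, 2 * (p : ℚ) ^ 2, 0⟩ : WeierstrassCurve ℚ).quadraticTwist (NumberField.discr K : ℚ)).entireLFunction 1 ≠ 0 ∧
        NumberField.classNumber K < p ∧ ¬ p ∣ NumberField.classNumber K := by
  intro p hpF _ _ _ hp8 hcase
  rcases hcase with h5 | h | h | h | h | h | ⟨hJ, hge⟩ | ⟨hJ, hge⟩ | ⟨hJ, hge⟩ | ⟨hJ, hge⟩ | ⟨hJ, hge⟩ | ⟨hJ, hge⟩ | ⟨hJ, hge⟩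
  · exact cruxOnBpCornerLadder_of_two_facts hBT hH p hp8 (Or.inl h5)
  · exact cruxOnBpCornerLadder_of_two_facts hBT hH p hp8 (Or.inr (Or.inl h))
  · exact cruxOnBpCornerLadder_of_two_facts hBT hH p hp8 (Or.inr (Or.inr (Or.inl h)))
  · exact cruxOnBpCornerLadder_of_two_facts hBT hH p hp8 (Or.inr (Or.inr (Or.inr (Or.inl h))))
  · exact cruxOnBpCornerLadder_of_two_facts hBT hH p hp8 (Or.inr (Or.inr (Or.inr (Or.inr (Or.inl h)))))
  · exact cruxOnBpCornerLadder_of_two_facts hBT hH p hp8 (Or.inr (Or.inr (Or.inr (Or.inr (Or.inr h)))))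
  · exact cruxOnBpCornerPartner_of_two_facts hBT hH (by norm_num) (by norm_num) hkey_oneHundredOne p hp8
      (by exact_mod_cast hJ) hge
  · exact cruxOnBpCornerPartner_of_two_facts hBT hH (by norm_num) (by norm_num) hkey_oneHundredNine p hp8
      (by exact_mod_cast hJ) hge
  · exact cruxOnBpCornerPartner_of_two_facts hBT hH (by norm_num) (by norm_num) hkey_oneHundredFortyNine p hp8
      (by exact_mod_cast hJ) hge
  · exact cruxOnBpCornerPartner_of_two_facts hBT hH (by norm_num) (by norm_num) hkey_oneHundredFiftySeven p hp8
      (by exact_mod_cast hJ) hge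
  · exact cruxOnBpCornerPartner_of_two_facts hBT hH (by norm_num) (by norm_num) hkey_oneHundredSeventyThree p hp8
      (by exact_mod_cast hJ) hge
  · exact cruxOnBpCornerPartner_of_two_facts hBT hH (by norm_num) (by norm_num) hkey_oneHundredEightyOne p hp8
      (by exact_mod_cast hJ) hge
  · exact cruxOnBpCornerPartner_of_two_facts hBT hH (by norm_num) (by norm_num) hkey_oneHundredNinetySeven p hp8
      (by exact_mod_cast hJ) hge

end Summit.BirchSwinnertonDyer.BirchSwinnertonDyer.Theorems.BiquadraticEisensteinDescentHeegnerTwistCouplingInSupplySqrtTwoLadder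

end
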